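import Summits.CriticalPhenomena.PercolationContinuityZ3.Theorems.PercNearOneGluingNoHeavyPcintOSMBridge
import Summits.CriticalPhenomena.PercolationContinuityZ3.Theorems.PercNearOneGluingNoHeavyPcintOSMTail
import Literature.Probability.Percolation.CoveringStrictMonotonicityAssembly
import HarnessLib

/-!
# PCINT lane, PHASE 4 (kernel second-moment oriented route), step 6: the Cox–Durrett bound assembled

Cell `prim-pcint`, seat `prim-pcint-1` (gen 13); memo `run/shared/lean/prim/pcint/T-FIBRE-ROUTE.md` §PHASE 4.

**`OSM.criticalProb_le_of_green`**: if `Σ_{k<n} u d k ≤ G` for every `n` (a bound for the Green's function of the pair of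
independent oriented walks), then `p_c^bond(ℤ^d) ≤ G / (d + G)`.  For `p > G/(d+G)` one has `(1/p − 1) G / d < 1`, the
renewal bound (`OSM.S_zero_le`) and the bridge (`OSM.le_real_armEvent`) give `P_p(0 ⟷ ∂B(0,m)) ≥ 1 − (1/p−1)G/d > 0` for
every `m`, hence `θ(p) > 0` (`DCTQ.le_theta_of_forall_le_real_armEvent`) and `p_c ≤ p`.  This is the oriented-percolation
second-moment bound of Cox–Durrett [Cox–Durrett 1983, Math. Proc. Camb. Phil. Soc. 93, (2.1)] `p⃗_c(ℤ^d) ≤ G/(d+G)` composed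
with `p_c ≤ p⃗_c` (an open oriented path is an open path), proved here from first principles for the tree's
`criticalProb (zdGraph d) 0`.  With the explicit Green's-function bound `OSM.Gplus` (`…OSMTail`):
**`OSM.criticalProb_le_of_Gplus_le`** — the form decided by the kernel in `…OSMZ{d}.lean`.
-/

noncomputable section

namespace Summit.CriticalPhenomena.PercolationContinuityZ3.Theorems.Pcint.OSM

open Finset Literature.Probability.Percolation Literature.Probability.LatticeModels

variable {d : ℕ}

/-- **Positivity of `θ` above the second-moment threshold**: if `Σ_{k<n} u d k ≤ G` for all `n` and
`(1/p − 1) G / d < 1`, then `θ(p) ≥ 1 − (1/p − 1) G / d > 0`. -/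
theorem le_theta [NeZero d] {G : ℝ} (hG : ∀ n, ∑ k ∈ range n, u d k ≤ G) (p : unitInterval) (hp : 0 < (p : ℝ))
    (hc : (1 / (p : ℝ) - 1) / d * G < 1) :
    1 - (1 / (p : ℝ) - 1) / d * G ≤ theta (zdGraph d) (0 : Site d) p := by
  have hd : 0 < d := Nat.pos_of_ne_zero (NeZero.ne d)
  have hdR : (0 : ℝ) < d := by exact_mod_cast hd
  have hx : (1 : ℝ) ≤ 1 / (p : ℝ) := by rw [le_div_iff₀ hp, one_mul]; exact p.2.2
  refine DCTQ.le_theta_of_forall_le_real_armEvent p 0 fun m => ?_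
  refine le_trans ?_ (le_real_armEvent p hp m)
  -- `S ≤ d^{2n} / (1 - c G)` gives `d^{2n} / S ≥ 1 - c G`
  have hS := S_zero_le hd hx hG hc (m + 1)
  have hpos : 0 < 1 - (1 / (p : ℝ) - 1) / d * G := by linarith
  have hSpos : 0 < S d (1 / p) (m + 1) 0 := by
    unfold S
    exact Finset.sum_pos (fun w _ => Finset.sum_pos (fun w' _ => by positivity) univ_nonempty) univ_nonempty
  rw [le_div_iff₀ hSpos]
  calc (1 - (1 / (p : ℝ) - 1) / d * G) * S d (1 / p) (m + 1) 0
      ≤ (1 - (1 / (p : ℝ) - 1) / d * G) * ((d : ℝ) ^ (2 * (m + 1)) / (1 - (1 / (p : ℝ) - 1) / d * G)) :=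
        mul_le_mul_of_nonneg_left hS hpos.le
    _ = (d : ℝ) ^ (2 * (m + 1)) := by rw [mul_div_assoc', mul_div_cancel_left₀ _ hpos.ne']

/-- **The Cox–Durrett second-moment bound**: `Σ_{k<n} u d k ≤ G` for all `n` implies `p_c^bond(ℤ^d) ≤ G / (d + G)`. -/
theorem criticalProb_le_of_green [NeZero d] {G : ℝ} (hG : ∀ n, ∑ k ∈ range n, u d k ≤ G) :
    criticalProb (zdGraph d) (0 : Site d) ≤ G / (d + G) := by
  have hd : 0 < d := Nat.pos_of_ne_zero (NeZero.ne d)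
  have hdR : (0 : ℝ) < d := by exact_mod_cast hd
  have hG0 : 0 ≤ G := le_trans (by simp) (hG 0)
  refine le_of_forall_gt_imp_ge_of_dense fun t ht => ?_
  by_cases ht1 : t ≤ 1
  · have hρ0 : 0 ≤ G / (d + G) := by positivity
    have ht0 : 0 < t := lt_of_le_of_lt hρ0 ht
    have hc : (1 / t - 1) / d * G < 1 := by
      -- `t > G/(d+G)` iff `(1/t - 1) G < d`
      rw [div_mul_eq_mul_div, div_lt_one hdR]
      have h1 : G < t * (d + G) := by rwa [div_lt_iff₀ (by positivity)] at ht
      have : (1 / t - 1) * G = (G - t * G) / t := by field_simp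
      rw [this, div_lt_iff₀ ht0]
      nlinarith
    have hθ := le_theta hG ⟨t, ht0.le, ht1⟩ ht0 hc
    have hpos : 0 < theta (zdGraph d) (0 : Site d) ⟨t, ht0.le, ht1⟩ := lt_of_lt_of_le (by linarith) hθ
    exact OrbitQuotient.criticalProb_le_of_theta_pos (zdGraph d) 0 ⟨t, ht0.le, ht1⟩ hpos
  · exact (criticalProb_mem_Icc _ _).2.trans (le_of_not_ge ht1)

/-- **Kernel form**: for `d ≥ 5`, `q₀ ≥ 1`, any `g ≥ Gplus d q₀` and any `c ≥ g/(d+g)`, `p_c^bond(ℤ^d) ≤ c`. -/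
theorem criticalProb_le_of_Gplus_le (hd : 5 ≤ d) {q₀ : ℕ} (hq₀ : 1 ≤ q₀) {g c : ℝ} (hg : Gplus d q₀ ≤ g)
    (hc : g / (d + g) ≤ c) : criticalProb (zdGraph d) (0 : Site d) ≤ c := by
  haveI : NeZero d := ⟨by omega⟩
  have hdR : (0 : ℝ) < d := by exact_mod_cast (show 0 < d by omega)
  have hG0 : 0 ≤ Gplus d q₀ := le_trans (by simp) (sum_u_le_Gplus hd hq₀ 0)
  refine (criticalProb_le_of_green (sum_u_le_Gplus hd hq₀)).trans (le_trans ?_ hc)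
  -- `G ↦ G/(d+G)` is non-decreasing
  rw [div_le_div_iff₀ (by positivity) (by linarith)]
  nlinarith

end Summit.CriticalPhenomena.PercolationContinuityZ3.Theorems.Pcint.OSM

end
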